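import Summits.QuantumFields.YangMills.Theorems.UnitScaleTiltProp7CorrectedParamMajorant
import Summits.QuantumFields.YangMills.Theorems.UnitScaleTiltProp7KappaAtDiscCauchy
import Summits.QuantumFields.YangMills.Theorems.UnitScaleTiltProp7AvgHessGaugeHqGOfFR2
import HarnessLib

/-!
# (q-gauge) SUPPLIER, «FR₂-lite» ROUTE R2 — F-D: **«FR₂-lite» PER MEMBER FROM THE s-FREE MAJORANT AND THE CAUCHY DOOR, AND ✓p768852's `hqG` CLOSED** —
# `Σ_z ‖κY Y x A z‖ ≤ C(L)·ℓ⁻²·s·‖A‖` at every printed-regular background, hence T1's displayed gauge-spike row `hqG` with `qG L := 240 + 6·C L`, NO letter displayed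

Cell `ym3-torus` (HUMAN RULING D-0037, YM ladder rung R3 — SU(2) YM₃ on T³: NOT d = 4, NOT infinite volume, NOT a mass gap, NOT Clay).  Width seat `ym3-torus-px12` (gen 18), pen «F-D» of
px16 g15's route R2 (GO 2026-08-30T17:08Z; px16: F-A ∕ F-B ∕ F-B′1 ∕ F-B′2 = the s-free majorant; px12: F-C ✓p781064 = holomorphy + Cauchy, F-D = this knit).  THEOREMS ONLY (0 `def`, 0 `sorry`,
default heartbeats); `--supports stmt-QuantumFields-19200 --as helper`; count-neutral; NO claim on crux ∕ stub ∕ registry.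

THE MATHEMATICS.  F-B′2 ★★★`Prop7CorrectedParamMajorant.exists_sfree_majorant`: at `U₀ ∈ 𝔘(ε₀)` (`10¹²L³ε₀ ≤ 1`, `10⁹L²e ≤ 1`, `0 < e`) there is an `A`-free site majorant `M` of
the frame-corrected parameter `κ_x(A)` on the whole chart polydisc `‖A(b)‖ ≤ e·η`, with mass `Σ_x M x ≤ C_B·(ℓ⁻¹)³·Σ_x‖N x‖`, `C_B = ∏_{j<K−n}((1 + 48δ_j) + 600δ_j·L³)`,
`δ_j = 60L(2e + 2700Lε₀)·Lʲη`.  F-C ★★★`Prop7KappaAtDiscCauchy.sum_norm_kappaY_le_of_majorant` (Cauchy on the circle `‖s‖ = e·η∕sY`): `Σ_x‖κY(x)‖ ≤ (C_B∕e)·(ℓ⁻¹)²·sY·Σ‖N‖`.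
§1 makes `C_B` L-ONLY: `1 + t ≤ eᵗ` and the geometric sum `η·Σ_{j<K−n} Lʲ ≤ 1` give `C_B ≤ exp((48 + 600L³)·60L(2e + 2700Lε₀))`.  §2 is the member row for ANY `N`, ANY averaging
sequence (the `sY ↓ s` limit removes F-C's `0 < sY`).  §3: for the spike `N = δ_x⊗A`, `Σ‖N‖ = ‖A‖`; with `e := (10⁹L²)⁻¹` and the averaging sequences built by `Nat.rec` from ✓p777532's
`hsucc` text, ✓p777532 ★★★`hqG_of_FR2_family` turns the member rows into ✓p768852's ∕ T1 ✓p776596's displayed `hqG` — CLOSED, `qG L = 240 + 6·C L`,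
`C L = 10⁹L²·exp((48 + 600L³)·60L·(2(10⁹L²)⁻¹ + 2700·L·α L))`.

WHAT IS PROVED (namespace `…Theorems.Prop7AvgHessGaugeHqGClosed`).
* §1 `eta_mul_geom_sum_le_one`, ★`prod_step_le_exp` — the tower product is `≤ exp((48+600L³)·60L(2e+2700Lε₀))` (L-only).
* §2 `sum_norm_single_le`, ★★★`sum_norm_kappaY_le_FR2_member` — «FR₂-lite» at the member for any `N`, `ns`: `Σ_x‖κY(x)‖ ≤ (exp(…)∕e)·((L^(K−n))⁻¹)²·s·Σ_x‖N x‖` (`‖Y b‖ ≤ s`).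
* §3 ★★★★`hqG_family_closed` — T1 ✓`tjDivRows_family_of_h133_hqG`'s ∕ O2's ∕ S5x's displayed binder `hqGrow` INHABITED at `αq := α`, `qG L := 240 + 6·C L` for every `α` in the windows
  `0 < α L`, `10¹⁰L⁶α L ≤ 1`, `10¹²L³α L ≤ 1` (and `qG L ≥ 0`: `qG_family_closed_nonneg`).
HONEST SCOPE.  A knit of landed∕signed letters; norm_H₁, norm_G, the 8 EX rows, EX, the crux and rung R3 are NOT proved; the Yang–Mills mass gap is NOT proved.

References: T. Bałaban, CMP **99** (1985) 389–434 [Balaban1985BackgroundPropagators] ((3.19) p.393, (3.114)–(3.115) p.418); CMP **98** (1985) 17–51 [Balaban1985Averaging] ((97) p.32,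
Prop. 4 p.38, Prop. 5 (157) p.42, (161)–(163) p.42).
-/

set_option autoImplicit false

noncomputable section

open scoped Topology Matrix.Norms.L2Operator BigOperators
open Filter NormedSpace Finset

namespace Summit.QuantumFields.YangMills.Theorems.Prop7AvgHessGaugeHqGClosed

open Literature.MathematicalPhysics.QuantumFieldTheory.Balaban1983to89
open Literature.MathematicalPhysics.QuantumFieldTheory.Balaban1983to89.T3ContinuumYM3Torus
open MatrixLog (mlog)
open B10Eq27TorusAxialLog (holT transl)
open B7Prop1Explicit (expUnit disp)
open B7TransferAnalyticMean (meanCLM)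
open T4Continuum BlockAveraging
open T3PrintedRegularMinimiser (RegPr)
open T3SectALandauChart (bgUnits eta eta_pos)
open B15DeterminingSets (embIter)
open Summit.QuantumFields.YangMills.Theorems.Prop8Chart (emlIterU)
open Summit.QuantumFields.YangMills.Theorems.Prop7SymAvgTwSym (frameAccU)
open Summit.QuantumFields.YangMills.Theorems.Prop7SectET3HilbertLetters (toL2 toL2S DL2)
open Summit.QuantumFields.YangMills.Theorems.Prop7SectET3DeltaOne (avgHess)
open Summit.QuantumFields.YangMills.Theorems.Prop7CorrectedParamMajorant (exists_sfree_majorant)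
open Summit.QuantumFields.YangMills.Theorems.Prop7KappaAtDiscCauchy (norm_smul_apply_le_of_le sum_norm_kappaY_le_of_majorant)
open Summit.QuantumFields.YangMills.Theorems.Prop7AvgHessGaugeHqGOfFR2 (hqG_of_FR2_family)

/-! ## §1 The tower product is L-only -/

section Member

variable (F : T3Family) {n K : ℕ} (h : n ≤ K)

/-- **THE GEOMETRIC SUM OF THE TOWER CLOSENESS**: `η·Σ_{i<K−n} Lⁱ ≤ 1` (`η = L^{−(K−n)}`, `L ≥ 2`). [cite: Balaban1985Averaging, (161)–(163) p.42] -/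
theorem eta_mul_geom_sum_le_one : eta F n K * ∑ i ∈ range (K - n), (F.L : ℝ) ^ i ≤ 1 := by
  have hL3 : 3 ≤ F.L := by obtain ⟨a, ha⟩ := F.hL.1; have := F.hL.2; omega
  have hL2 : (2 : ℝ) ≤ (F.L : ℝ) := by exact_mod_cast (le_trans (by norm_num) hL3)
  have hL1 : (1 : ℝ) < (F.L : ℝ) := by linarith
  have hη : eta F n K = ((F.L : ℝ) ^ (K - n))⁻¹ := by
    show ((F.L : ℝ)⁻¹) ^ (K - n) = _
    rw [inv_pow]
  have hpow : (0 : ℝ) < (F.L : ℝ) ^ (K - n) := pow_pos (by linarith) _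
  have hgeom : ∑ i ∈ range (K - n), (F.L : ℝ) ^ i ≤ (F.L : ℝ) ^ (K - n) := by
    rw [geom_sum_eq hL1.ne' (K - n)]
    have h1 : (1 : ℝ) ≤ (F.L : ℝ) - 1 := by linarith
    have h2 : (0 : ℝ) ≤ (F.L : ℝ) ^ (K - n) - 1 := by linarith [one_le_pow₀ (M₀ := ℝ) hL1.le (n := K - n)]
    calc ((F.L : ℝ) ^ (K - n) - 1) / ((F.L : ℝ) - 1) ≤ (F.L : ℝ) ^ (K - n) - 1 := div_le_self h2 h1
      _ ≤ (F.L : ℝ) ^ (K - n) := by linarith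
  rw [hη]
  calc ((F.L : ℝ) ^ (K - n))⁻¹ * ∑ i ∈ range (K - n), (F.L : ℝ) ^ i ≤ ((F.L : ℝ) ^ (K - n))⁻¹ * (F.L : ℝ) ^ (K - n) :=
        mul_le_mul_of_nonneg_left hgeom (inv_nonneg.2 hpow.le)
    _ = 1 := inv_mul_cancel₀ hpow.ne'

/-- ★ **THE TOWER PRODUCT OF F-B′2 IS L-ONLY**: `∏_{i<K−n} ((1 + 48δ_i) + 600δ_i·L³) ≤ exp((48 + 600L³)·60L(2e + 2700Lε₀))` for `0 ≤ e`, `0 ≤ ε₀` — `1 + t ≤ eᵗ` termwise, `∏ exp = exp Σ`,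
and §1's geometric sum. [cite: Balaban1985Averaging, (161)–(163) p.42] -/
theorem prod_step_le_exp {ε₀ e : ℝ} (hε₀ : 0 ≤ ε₀) (he : 0 ≤ e) :
    (∏ i ∈ range (K - n), ((1 + 48 * (60 * (F.L : ℝ) * ((2 * e + 2700 * (F.L : ℝ) * ε₀) * ((F.L : ℝ) ^ i * eta F n K)))) + 600 * (60 * (F.L : ℝ) * ((2 * e + 2700 * (F.L : ℝ) * ε₀) * ((F.L : ℝ) ^ i * eta F n K))) * (F.L : ℝ) ^ 3)) ≤ Real.exp ((48 + 600 * (F.L : ℝ) ^ 3) * (60 * (F.L : ℝ) * (2 * e + 2700 * (F.L : ℝ) * ε₀))) := by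
  have hL0 : (0 : ℝ) ≤ (F.L : ℝ) := Nat.cast_nonneg _
  have hη0 : 0 ≤ eta F n K := (eta_pos F n K).le
  set B : ℝ := (48 + 600 * (F.L : ℝ) ^ 3) * (60 * (F.L : ℝ) * (2 * e + 2700 * (F.L : ℝ) * ε₀)) with hB
  have hB0 : 0 ≤ B := by rw [hB]; positivity
  -- termwise `1 + t ≤ exp t`
  have hterm : ∀ i ∈ range (K - n), ((1 + 48 * (60 * (F.L : ℝ) * ((2 * e + 2700 * (F.L : ℝ) * ε₀) * ((F.L : ℝ) ^ i * eta F n K)))) + 600 * (60 * (F.L : ℝ) * ((2 * e + 2700 * (F.L : ℝ) * ε₀) * ((F.L : ℝ) ^ i * eta F n K))) * (F.L : ℝ) ^ 3)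
      ≤ Real.exp (B * (eta F n K * (F.L : ℝ) ^ i)) := fun i _ => by
    have heq : ((1 + 48 * (60 * (F.L : ℝ) * ((2 * e + 2700 * (F.L : ℝ) * ε₀) * ((F.L : ℝ) ^ i * eta F n K)))) + 600 * (60 * (F.L : ℝ) * ((2 * e + 2700 * (F.L : ℝ) * ε₀) * ((F.L : ℝ) ^ i * eta F n K))) * (F.L : ℝ) ^ 3) = B * (eta F n K * (F.L : ℝ) ^ i) + 1 := by rw [hB]; ring
    rw [heq]
    exact Real.add_one_le_exp _
  have hnonneg : ∀ i ∈ range (K - n), 0 ≤ ((1 + 48 * (60 * (F.L : ℝ) * ((2 * e + 2700 * (F.L : ℝ) * ε₀) * ((F.L : ℝ) ^ i * eta F n K)))) + 600 * (60 * (F.L : ℝ) * ((2 * e + 2700 * (F.L : ℝ) * ε₀) * ((F.L : ℝ) ^ i * eta F n K))) * (F.L : ℝ) ^ 3) := fun i _ => by positivity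
  calc (∏ i ∈ range (K - n), ((1 + 48 * (60 * (F.L : ℝ) * ((2 * e + 2700 * (F.L : ℝ) * ε₀) * ((F.L : ℝ) ^ i * eta F n K)))) + 600 * (60 * (F.L : ℝ) * ((2 * e + 2700 * (F.L : ℝ) * ε₀) * ((F.L : ℝ) ^ i * eta F n K))) * (F.L : ℝ) ^ 3)) ≤ ∏ i ∈ range (K - n), Real.exp (B * (eta F n K * (F.L : ℝ) ^ i)) := prod_le_prod hnonneg hterm
    _ = Real.exp (∑ i ∈ range (K - n), B * (eta F n K * (F.L : ℝ) ^ i)) := (Real.exp_sum _ _).symm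
    _ = Real.exp (B * (eta F n K * ∑ i ∈ range (K - n), (F.L : ℝ) ^ i)) := by rw [← mul_sum, ← mul_sum]
    _ ≤ Real.exp B := by
        refine Real.exp_le_exp.2 ?_
        calc B * (eta F n K * ∑ i ∈ range (K - n), (F.L : ℝ) ^ i) ≤ B * 1 := mul_le_mul_of_nonneg_left (eta_mul_geom_sum_le_one F) hB0
          _ = B := mul_one B

/-! ## §2 «FR₂-lite» at the member, any gauge parameter, any averaging sequence -/

/-- **THE SPIKE HAS MASS `‖A‖`**: `Σ_x ‖(δ_{x₀}⊗A)(x)‖ ≤ ‖A‖`. [folklore] -/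
theorem sum_norm_single_le (x₀ : Site (F.P K) 0) (A : Matrix (Fin 2) (Fin 2) ℂ) :
    ∑ x : Site (F.P K) 0, ‖(Pi.single x₀ A : Site (F.P K) 0 → Matrix (Fin 2) (Fin 2) ℂ) x‖ ≤ ‖A‖ := by
  rw [Finset.sum_eq_single x₀ (fun x _ hx => by rw [Pi.single_eq_of_ne hx, norm_zero]) (fun hx => absurd (Finset.mem_univ x₀) hx)]
  rw [Pi.single_eq_same]

include h in
/-- ★★★ **«FR₂-lite» AT THE MEMBER**: for `U₀ ∈ 𝔘(ε₀)`, `10¹²L³ε₀ ≤ 1`, `10⁹L²e ≤ 1`, `0 < e`, a chart direction `Y` with `‖Y(b)‖ ≤ s`, ANY gauge parameter `N` with averaging sequence `ns`: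
**`Σ_x ‖κY(x)‖ ≤ (exp((48+600L³)·60L(2e+2700Lε₀))∕e)·((L^(K−n))⁻¹)²·s·Σ_x‖N x‖`** — F-B′2's s-free majorant in F-C's Cauchy socket (radius `e·η∕(s+τ)`, `τ ↓ 0`), then §1.
`κY(x)` is F4 ✓`hasDerivAt_kappaAt_smul_site`'s derivative VERBATIM. [cite: Balaban1985BackgroundPropagators, (3.114)–(3.115) p.418; Balaban1985Averaging, (97) p.32, Prop. 4 p.38] -/
theorem sum_norm_kappaY_le_FR2_member {ε₀ e : ℝ} (hε₀ : 0 < ε₀) (he : 0 < e) (hWε : 10 ^ 12 * (F.L : ℝ) ^ 3 * ε₀ ≤ 1) (hWe : 10 ^ 9 * (F.L : ℝ) ^ 2 * e ≤ 1)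
    (U₀ : GaugeField (F.P K) 0 (Matrix.specialUnitaryGroup (Fin 2) ℂ)) (hreg : RegPr F n K ε₀ U₀) (Y : PBond (F.P K) 0 → Matrix (Fin 2) (Fin 2) ℂ) (s : ℝ) (hY : ∀ b, ‖Y b‖ ≤ s)
    (N : Site (F.P K) 0 → Matrix (Fin 2) (Fin 2) ℂ) (ns : (j : ℕ) → Site (F.P K) j → Matrix (Fin 2) (Fin 2) ℂ) (h0 : ns 0 = N)
    (hsucc : ∀ (j : ℕ) (z : Site (F.P K) (j + 1)), ns (j + 1) z = ns j (emb z) - meanCLM (Idx (F.P K)) (Matrix (Fin 2) (Fin 2) ℂ) fun i : Idx (F.P K) =>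
        ns j (emb z) - ((holT (emlIterU j (bgUnits F K U₀)) (emb z) (stairWord i.2.1 (off i.1)) : (Matrix (Fin 2) (Fin 2) ℂ)ˣ) : Matrix (Fin 2) (Fin 2) ℂ) *
          ns j (transl (emb z) (disp (stairWord i.2.1 (off i.1)))) * (((holT (emlIterU j (bgUnits F K U₀)) (emb z) (stairWord i.2.1 (off i.1)))⁻¹ : (Matrix (Fin 2) (Fin 2) ℂ)ˣ) : Matrix (Fin 2) (Fin 2) ℂ)) :
    ∑ x : Site (F.P K) (K - n), ‖(ns (K - n) x * fderiv ℂ (fun A : PBond (F.P K) 0 → Matrix (Fin 2) (Fin 2) ℂ => ((frameAccU (K - n) (bgUnits F K U₀) (fun b => expUnit (A b) * bgUnits F K U₀ b) x : (Matrix (Fin 2) (Fin 2) ℂ)ˣ) : Matrix (Fin 2) (Fin 2) ℂ)) 0 Y - fderiv ℂ (fun A : PBond (F.P K) 0 → Matrix (Fin 2) (Fin 2) ℂ => ((frameAccU (K - n) (bgUnits F K U₀) (fun b => expUnit (A b) * bgUnits F K U₀ b) x : (Matrix (Fin 2) (Fin 2) ℂ)ˣ) : Matrix (Fin 2) (Fin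 2) ℂ)) 0 Y * ns (K - n) x) + (N (embIter (K - n) x) - ns (K - n) x) * fderiv ℂ (fun A : PBond (F.P K) 0 → Matrix (Fin 2) (Fin 2) ℂ => ((frameAccU (K - n) (bgUnits F K U₀) (fun b => expUnit (A b) * bgUnits F K U₀ b) x : (Matrix (Fin 2) (Fin 2) ℂ)ˣ) : Matrix (Fin 2) (Fin 2) ℂ)) 0 Y - (fderiv ℂ (fderiv ℂ (fun A : PBond (F.P K) 0 → Matrix (Fin 2) (Fin 2) ℂ => ((frameAccU (K - n) (bgUnits F K U₀) (fun b => expUnit (A b) * bgUnits F K U₀ b) x : (Matrix (Fin 2) (Fin 2) ℂ)ˣ) : Matrix (Fin 2) (Fin 2) ℂ))) 0 Y (fun b : PBond (F.P K) 0 => N b.src - ((bgUnits F K U₀ b : (Matrix (Fin 2) (Fin 2) ℂ)ˣ) : Matrix (Fin 2) (Fin 2) ℂ) * N b.tgt * (((bgUnits F K U₀ b)⁻¹ : (Matrix (Fin 2) (Fin 2) ℂ)ˣ) : Matrix (Fin 2) (Fin 2) ℂ)) + fderiv ℂ (fun A : PBond (F.P K) 0 → Matrix (Fin 2) (Fin 2)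 ℂ => ((frameAccU (K - n) (bgUnits F K U₀) (fun b => expUnit (A b) * bgUnits F K U₀ b) x : (Matrix (Fin 2) (Fin 2) ℂ)ˣ) : Matrix (Fin 2) (Fin 2) ℂ)) 0 (fun b : PBond (F.P K) 0 => (2 : ℂ)⁻¹ • ((N b.src + ((bgUnits F K U₀ b : (Matrix (Fin 2) (Fin 2) ℂ)ˣ) : Matrix (Fin 2) (Fin 2) ℂ) * N b.tgt * (((bgUnits F K U₀ b)⁻¹ : (Matrix (Fin 2) (Fin 2) ℂ)ˣ) : Matrix (Fin 2) (Fin 2) ℂ)) * Y b - Y b * (N b.src + ((bgUnits F K U₀ b : (Matrix (Fin 2) (Fin 2) ℂ)ˣ) : Matrix (Fin 2) (Fin 2) ℂ) * N b.tgt * (((bgUnits F K U₀ b)⁻¹ : (Matrix (Fin 2) (Fin 2) ℂ)ˣ) : Matrix (Fin 2) (Fin 2) ℂ)))))‖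
      ≤ Real.exp ((48 + 600 * (F.L : ℝ) ^ 3) * (60 * (F.L : ℝ) * (2 * e + 2700 * (F.L : ℝ) * ε₀))) / e * ((((F.L : ℝ) ^ (K - n))⁻¹) ^ 2) * s * ∑ x₀ : Site (F.P K) 0, ‖N x₀‖ := by
  obtain ⟨Mj, hsum, hM⟩ := exists_sfree_majorant F h hε₀ he hWe hWε U₀ hreg N
  obtain ⟨b₀⟩ : Nonempty (PBond (F.P K) 0) := ⟨⟨Classical.arbitrary _, ⟨0, by rw [T3Family.P_d]; norm_num⟩⟩⟩
  have hs : 0 ≤ s := (norm_nonneg _).trans (hY b₀)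
  have hN : 0 ≤ ∑ x₀ : Site (F.P K) 0, ‖N x₀‖ := sum_nonneg fun _ _ => norm_nonneg _
  have hP0 : 0 ≤ (∏ i ∈ range (K - n), ((1 + 48 * (60 * (F.L : ℝ) * ((2 * e + 2700 * (F.L : ℝ) * ε₀) * ((F.L : ℝ) ^ i * eta F n K)))) + 600 * (60 * (F.L : ℝ) * ((2 * e + 2700 * (F.L : ℝ) * ε₀) * ((F.L : ℝ) ^ i * eta F n K))) * (F.L : ℝ) ^ 3)) := prod_nonneg fun i _ => by
    have : 0 ≤ eta F n K := (eta_pos F n K).le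
    have : (0 : ℝ) ≤ (F.L : ℝ) := Nat.cast_nonneg _
    positivity
  -- the Cauchy socket at every radius `e·η∕(s+τ)`, `τ > 0`
  set Cst : ℝ := (∏ i ∈ range (K - n), ((1 + 48 * (60 * (F.L : ℝ) * ((2 * e + 2700 * (F.L : ℝ) * ε₀) * ((F.L : ℝ) ^ i * eta F n K)))) + 600 * (60 * (F.L : ℝ) * ((2 * e + 2700 * (F.L : ℝ) * ε₀) * ((F.L : ℝ) ^ i * eta F n K))) * (F.L : ℝ) ^ 3)) / e * ((((F.L : ℝ) ^ (K - n))⁻¹) ^ 2) * ∑ x₀ : Site (F.P K) 0, ‖N x₀‖ with hCst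
  have hCst0 : 0 ≤ Cst := by rw [hCst]; positivity
  have key : ∀ τ : ℝ, 0 < τ → ∑ x : Site (F.P K) (K - n), ‖(ns (K - n) x * fderiv ℂ (fun A : PBond (F.P K) 0 → Matrix (Fin 2) (Fin 2) ℂ => ((frameAccU (K - n) (bgUnits F K U₀) (fun b => expUnit (A b) * bgUnits F K U₀ b) x : (Matrix (Fin 2) (Fin 2) ℂ)ˣ) : Matrix (Fin 2) (Fin 2) ℂ)) 0 Y - fderiv ℂ (fun A : PBond (F.P K) 0 → Matrix (Fin 2) (Fin 2) ℂ => ((frameAccU (K - n) (bgUnits F K U₀) (fun b => expUnit (A b) * bgUnits F K U₀ b) x : (Matrix (Fin 2) (Fin 2) ℂ)ˣ) : Matrix (Fin 2) (Fin 2) ℂ)) 0 Y * ns (K - n) x) + (N (embIter (K - n) x) - ns (K - n) x) * fderiv ℂ (fun A : PBond (F.P K) 0 → Matrix (Fin 2) (Fin 2) ℂ => ((frameAccU (K - n) (bgUnits F K U₀) (fun b => expUnit (A b) * bgUnits F K U₀ b) x : (Matrix (Fin 2) (Fin 2) ℂ)ˣ) : Matrix (Fin 2) (Fin 2) ℂ))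 0 Y - (fderiv ℂ (fderiv ℂ (fun A : PBond (F.P K) 0 → Matrix (Fin 2) (Fin 2) ℂ => ((frameAccU (K - n) (bgUnits F K U₀) (fun b => expUnit (A b) * bgUnits F K U₀ b) x : (Matrix (Fin 2) (Fin 2) ℂ)ˣ) : Matrix (Fin 2) (Fin 2) ℂ))) 0 Y (fun b : PBond (F.P K) 0 => N b.src - ((bgUnits F K U₀ b : (Matrix (Fin 2) (Fin 2) ℂ)ˣ) : Matrix (Fin 2) (Fin 2) ℂ) * N b.tgt * (((bgUnits F K U₀ b)⁻¹ : (Matrix (Fin 2) (Fin 2) ℂ)ˣ) : Matrix (Fin 2) (Fin 2) ℂ)) + fderiv ℂ (fun A : PBond (F.P K) 0 → Matrix (Fin 2) (Fin 2) ℂ => ((frameAccU (K - n) (bgUnits F K U₀) (fun b => expUnit (A b) * bgUnits F K U₀ b) x : (Matrix (Fin 2) (Fin 2) ℂ)ˣ) : Matrix (Fin 2) (Fin 2) ℂ)) 0 (fun b : PBond (F.P K) 0 => (2 : ℂ)⁻¹ • ((N b.src + ((bgUnits F K U₀ b : (Matrix (Fin 2) (Fin 2) ℂ)ˣ) : Matrix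 (Fin 2) (Fin 2) ℂ) * N b.tgt * (((bgUnits F K U₀ b)⁻¹ : (Matrix (Fin 2) (Fin 2) ℂ)ˣ) : Matrix (Fin 2) (Fin 2) ℂ)) * Y b - Y b * (N b.src + ((bgUnits F K U₀ b : (Matrix (Fin 2) (Fin 2) ℂ)ˣ) : Matrix (Fin 2) (Fin 2) ℂ) * N b.tgt * (((bgUnits F K U₀ b)⁻¹ : (Matrix (Fin 2) (Fin 2) ℂ)ˣ) : Matrix (Fin 2) (Fin 2) ℂ)))))‖ ≤ Cst * (s + τ) := fun τ hτ => by
    have hsY : 0 < s + τ := by linarith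
    have hY' : ∀ b, ‖Y b‖ ≤ s + τ := fun b => (hY b).trans (by linarith)
    have hdoor := sum_norm_kappaY_le_of_majorant F h hε₀ he hWε hWe U₀ hreg Y hsY hY' N ns h0 hsucc (M := Mj)
      (CB := (∏ i ∈ range (K - n), ((1 + 48 * (60 * (F.L : ℝ) * ((2 * e + 2700 * (F.L : ℝ) * ε₀) * ((F.L : ℝ) ^ i * eta F n K)))) + 600 * (60 * (F.L : ℝ) * ((2 * e + 2700 * (F.L : ℝ) * ε₀) * ((F.L : ℝ) ^ i * eta F n K))) * (F.L : ℝ) ^ 3))) (a := ∑ x₀ : Site (F.P K) 0, ‖N x₀‖)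
      (fun x σ hσ => hM (σ • Y) (fun b => norm_smul_apply_le_of_le F hY' (le_of_eq (by rw [hσ, div_mul_cancel₀ _ hsY.ne'])) b) x) hsum
    refine hdoor.trans (le_of_eq ?_)
    rw [hCst]; ring
  -- let `τ ↓ 0`
  have hlim : ∑ x : Site (F.P K) (K - n), ‖(ns (K - n) x * fderiv ℂ (fun A : PBond (F.P K) 0 → Matrix (Fin 2) (Fin 2) ℂ => ((frameAccU (K - n) (bgUnits F K U₀) (fun b => expUnit (A b) * bgUnits F K U₀ b) x : (Matrix (Fin 2) (Fin 2) ℂ)ˣ) : Matrix (Fin 2) (Fin 2) ℂ)) 0 Y - fderiv ℂ (fun A : PBond (F.P K) 0 → Matrix (Fin 2) (Fin 2) ℂ => ((frameAccU (K - n) (bgUnits F K U₀) (fun b => expUnit (A b) * bgUnits F K U₀ b) x : (Matrix (Fin 2) (Fin 2) ℂ)ˣ) : Matrix (Fin 2) (Fin 2) ℂ)) 0 Y * ns (K - n) x) + (N (embIter (K - n) x) - ns (K - n) x) * fderiv ℂ (fun A : PBond (F.P K) 0 → Matrix (Fin 2) (Fin 2) ℂ => ((frameAccU (K - n) (bgUnits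 F K U₀) (fun b => expUnit (A b) * bgUnits F K U₀ b) x : (Matrix (Fin 2) (Fin 2) ℂ)ˣ) : Matrix (Fin 2) (Fin 2) ℂ)) 0 Y - (fderiv ℂ (fderiv ℂ (fun A : PBond (F.P K) 0 → Matrix (Fin 2) (Fin 2) ℂ => ((frameAccU (K - n) (bgUnits F K U₀) (fun b => expUnit (A b) * bgUnits F K U₀ b) x : (Matrix (Fin 2) (Fin 2) ℂ)ˣ) : Matrix (Fin 2) (Fin 2) ℂ))) 0 Y (fun b : PBond (F.P K) 0 => N b.src - ((bgUnits F K U₀ b : (Matrix (Fin 2) (Fin 2) ℂ)ˣ) : Matrix (Fin 2) (Fin 2) ℂ) * N b.tgt * (((bgUnits F K U₀ b)⁻¹ : (Matrix (Fin 2) (Fin 2) ℂ)ˣ) : Matrix (Fin 2) (Fin 2) ℂ)) + fderiv ℂ (fun A : PBond (F.P K) 0 → Matrix (Fin 2) (Fin 2) ℂ => ((frameAccU (K - n) (bgUnits F K U₀) (fun b => expUnit (A b) * bgUnits F K U₀ b) x : (Matrix (Fin 2) (Fin 2) ℂ)ˣ) : Matrix (Fin 2) (Fin 2) ℂ)) 0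 (fun b : PBond (F.P K) 0 => (2 : ℂ)⁻¹ • ((N b.src + ((bgUnits F K U₀ b : (Matrix (Fin 2) (Fin 2) ℂ)ˣ) : Matrix (Fin 2) (Fin 2) ℂ) * N b.tgt * (((bgUnits F K U₀ b)⁻¹ : (Matrix (Fin 2) (Fin 2) ℂ)ˣ) : Matrix (Fin 2) (Fin 2) ℂ)) * Y b - Y b * (N b.src + ((bgUnits F K U₀ b : (Matrix (Fin 2) (Fin 2) ℂ)ˣ) : Matrix (Fin 2) (Fin 2) ℂ) * N b.tgt * (((bgUnits F K U₀ b)⁻¹ : (Matrix (Fin 2) (Fin 2) ℂ)ˣ) : Matrix (Fin 2) (Fin 2) ℂ)))))‖ ≤ Cst * s := by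
    refine le_of_forall_pos_le_add fun δ hδ => ?_
    have hτ : 0 < δ / (Cst + 1) := div_pos hδ (by linarith)
    refine (key _ hτ).trans ?_
    rw [mul_add]
    have : Cst * (δ / (Cst + 1)) ≤ δ := by
      rw [mul_div_assoc']
      exact (div_le_iff₀ (by linarith)).2 (by nlinarith)
    linarith
  refine hlim.trans ?_
  have hexp := prod_step_le_exp F (n := n) (K := K) hε₀.le he.le
  have hℓ : (0 : ℝ) ≤ (((F.L : ℝ) ^ (K - n))⁻¹) ^ 2 := by positivity
  calc Cst * s = (∏ i ∈ range (K - n), ((1 + 48 * (60 * (F.L : ℝ) * ((2 * e + 2700 * (F.L : ℝ) * ε₀) * ((F.L : ℝ) ^ i * eta F n K)))) + 600 * (60 * (F.L : ℝ) * ((2 * e + 2700 * (F.L : ℝ) * ε₀) * ((F.L : ℝ) ^ i * eta F n K))) * (F.L : ℝ) ^ 3)) / e * ((((F.L : ℝ) ^ (K - n))⁻¹) ^ 2) * s * ∑ x₀ : Site (F.P K) 0, ‖N x₀‖ := by rw [hCst]; ring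
    _ ≤ Real.exp ((48 + 600 * (F.L : ℝ) ^ 3) * (60 * (F.L : ℝ) * (2 * e + 2700 * (F.L : ℝ) * ε₀))) / e * ((((F.L : ℝ) ^ (K - n))⁻¹) ^ 2) * s * ∑ x₀ : Site (F.P K) 0, ‖N x₀‖ := by
        have hdiv : (∏ i ∈ range (K - n), ((1 + 48 * (60 * (F.L : ℝ) * ((2 * e + 2700 * (F.L : ℝ) * ε₀) * ((F.L : ℝ) ^ i * eta F n K)))) + 600 * (60 * (F.L : ℝ) * ((2 * e + 2700 * (F.L : ℝ) * ε₀) * ((F.L : ℝ) ^ i * eta F n K))) * (F.L : ℝ) ^ 3)) / e ≤ Real.exp ((48 + 600 * (F.L : ℝ) ^ 3) * (60 * (F.L : ℝ) * (2 * e + 2700 * (F.L : ℝ) * ε₀))) / e := div_le_div_of_nonneg_right hexp he.le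
        exact mul_le_mul_of_nonneg_right (mul_le_mul_of_nonneg_right (mul_le_mul_of_nonneg_right hdiv hℓ) hs) hN

end Member

/-! ## §3 ✓p768852's `hqG`, CLOSED -/

/-- ★★★★ **THE GAUGE-SPIKE ROW OF `avgHess` — T1 ✓`tjDivRows_family_of_h133_hqG`'s DISPLAYED `hqGrow` — HOLDS, NO LETTER**: for every cap `α` in the windows `0 < α L`, `10¹⁰L⁶α L ≤ 1`,
`10¹²L³α L ≤ 1` and every positive weight family `c₀`, at every `L > 1`, member `i`, `U₀ ∈ 𝔘_k(α L)`, bond field `X′` with `‖X′ b‖ ≤ s`, site `x`, `A`: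
`Σ_y ‖avgHess U₀ X′ (G_D(δ_x⊗A)) y‖ ≤ (240 + 6·C L)·(L^(K−n))⁻¹·s·‖A‖`, `C L := 10⁹L²·exp((48 + 600L³)·60L·(2(10⁹L²)⁻¹ + 2700·L·α L))` — ✓p777532 `hqG_of_FR2_family` over §2 at
`e := (10⁹L²)⁻¹`, `N := δ_x⊗A`, the `Nat.rec` averaging sequences. [cite: Balaban1985BackgroundPropagators, (3.114)–(3.115) p.418, (3.16) and (3.19) p.393; Balaban1985Averaging, (97) p.32,
Prop. 5 (157) p.42] -/
theorem hqG_family_closed (α : ℕ → ℝ) (c₀ : ℕ → ℝ) [hc₀ : ∀ L : ℕ, Fact (0 < c₀ L)]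
    (hα0 : ∀ L : ℕ, 1 < L → 0 < α L) (hα10 : ∀ L : ℕ, 1 < L → 10 ^ 10 * (L : ℝ) ^ 6 * α L ≤ 1) (hα12 : ∀ L : ℕ, 1 < L → 10 ^ 12 * (L : ℝ) ^ 3 * α L ≤ 1) :
    ∀ (L : ℕ), 1 < L → ∀ (i : T3Thm1Carrier.Idx L) (U₀ : GaugeField (i.1.1.P i.1.2.2) 0 (Matrix.specialUnitaryGroup (Fin 2) ℂ)), RegPr i.1.1 i.1.2.1 i.1.2.2 (α L) U₀ →
      ∀ (X' : PBond (i.1.1.P i.1.2.2) 0 → Matrix (Fin 2) (Fin 2) ℂ) (s : ℝ) (x : Site (i.1.1.P i.1.2.2) 0) (A : Matrix (Fin 2) (Fin 2) ℂ), (∀ b, ‖X' b‖ ≤ s) →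
        ∑ y : PBond (i.1.1.P i.1.2.1) 0, ‖avgHess i.1.1 i.1.2.1 i.1.2.2 i.2.2.le U₀ X'
            ((toL2 i.1.1 i.1.2.2 (c₀ L)).symm (DL2 i.1.1 i.1.2.1 i.1.2.2 (c₀ L) U₀ (toL2S i.1.1 i.1.2.2 (c₀ L) (Pi.single x A)))) y‖
          ≤ (240 + 6 * ((10 ^ 9 * (L : ℝ) ^ 2) * Real.exp ((48 + 600 * (L : ℝ) ^ 3) * (60 * (L : ℝ) * (2 * (10 ^ 9 * (L : ℝ) ^ 2)⁻¹ + 2700 * (L : ℝ) * α L)))))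
            * ((L : ℝ) ^ (i.1.2.2 - i.1.2.1))⁻¹ * s * ‖A‖ := by
  set NS : (L : ℕ) → (i : T3Thm1Carrier.Idx L) → GaugeField (i.1.1.P i.1.2.2) 0 (Matrix.specialUnitaryGroup (Fin 2) ℂ) →
      Site (i.1.1.P i.1.2.2) 0 → Matrix (Fin 2) (Fin 2) ℂ → (j : ℕ) → Site (i.1.1.P i.1.2.2) j → Matrix (Fin 2) (Fin 2) ℂ :=
    fun L i U₀ x A j => @Nat.rec (fun j => Site (i.1.1.P i.1.2.2) j → Matrix (Fin 2) (Fin 2) ℂ) (Pi.single x A)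
      (fun j f z => f (emb z) - meanCLM (Idx (i.1.1.P i.1.2.2)) (Matrix (Fin 2) (Fin 2) ℂ) fun r : Idx (i.1.1.P i.1.2.2) =>
        f (emb z) - ((holT (emlIterU j (bgUnits i.1.1 i.1.2.2 U₀)) (emb z) (stairWord r.2.1 (off r.1)) : (Matrix (Fin 2) (Fin 2) ℂ)ˣ) : Matrix (Fin 2) (Fin 2) ℂ) *
          f (transl (emb z) (disp (stairWord r.2.1 (off r.1)))) * (((holT (emlIterU j (bgUnits i.1.1 i.1.2.2 U₀)) (emb z) (stairWord r.2.1 (off r.1)))⁻¹ : (Matrix (Fin 2) (Fin 2) ℂ)ˣ) : Matrix (Fin 2) (Fin 2) ℂ)) j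
    with hNS
  refine hqG_of_FR2_family α c₀ hα0 hα10 hα12 NS (fun L i U₀ x A => rfl) (fun L i U₀ x A j y => rfl)
    (fun L => ((10 ^ 9 * (L : ℝ) ^ 2) * Real.exp ((48 + 600 * (L : ℝ) ^ 3) * (60 * (L : ℝ) * (2 * (10 ^ 9 * (L : ℝ) ^ 2)⁻¹ + 2700 * (L : ℝ) * α L))))) ?_
  intro L hL i U₀ hU Y s x A hY
  have hLi : (i.1.1.L : ℝ) = (L : ℝ) := by exact_mod_cast i.2.1
  have hL0 : (0 : ℝ) < (L : ℝ) := by exact_mod_cast lt_trans zero_lt_one hL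
  have hpos : (0 : ℝ) < 10 ^ 9 * (L : ℝ) ^ 2 := by positivity
  have he : 0 < (10 ^ 9 * (L : ℝ) ^ 2)⁻¹ := inv_pos.2 hpos
  have hWe : 10 ^ 9 * (i.1.1.L : ℝ) ^ 2 * (10 ^ 9 * (L : ℝ) ^ 2)⁻¹ ≤ 1 := by rw [hLi, mul_inv_cancel₀ hpos.ne']
  have hWε : 10 ^ 12 * (i.1.1.L : ℝ) ^ 3 * α L ≤ 1 := by rw [hLi]; exact hα12 L hL
  have hmem := sum_norm_kappaY_le_FR2_member i.1.1 i.2.2.le (hα0 L hL) he hWε hWe U₀ hU Y s hY (Pi.single x A) (NS L i U₀ x A) rfl (fun j z => rfl)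
  refine hmem.trans ?_
  obtain ⟨b₀⟩ : Nonempty (PBond (i.1.1.P i.1.2.2) 0) := ⟨⟨Classical.arbitrary _, ⟨0, by rw [T3Family.P_d]; norm_num⟩⟩⟩
  have hs : 0 ≤ s := (norm_nonneg _).trans (hY b₀)
  have hA := sum_norm_single_le i.1.1 (K := i.1.2.2) x A
  rw [hLi, div_inv_eq_mul]
  have hC0 : (0 : ℝ) ≤ Real.exp ((48 + 600 * (L : ℝ) ^ 3) * (60 * (L : ℝ) * (2 * (10 ^ 9 * (L : ℝ) ^ 2)⁻¹ + 2700 * (L : ℝ) * α L))) * (10 ^ 9 * (L : ℝ) ^ 2) * ((L : ℝ) ^ (i.1.2.2 - i.1.2.1))⁻¹ ^ 2 * s := by positivity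
  calc Real.exp ((48 + 600 * (L : ℝ) ^ 3) * (60 * (L : ℝ) * (2 * (10 ^ 9 * (L : ℝ) ^ 2)⁻¹ + 2700 * (L : ℝ) * α L))) * (10 ^ 9 * (L : ℝ) ^ 2) * ((L : ℝ) ^ (i.1.2.2 - i.1.2.1))⁻¹ ^ 2 * s
          * ∑ x₀ : Site (i.1.1.P i.1.2.2) 0, ‖(Pi.single x A : Site (i.1.1.P i.1.2.2) 0 → Matrix (Fin 2) (Fin 2) ℂ) x₀‖
      ≤ Real.exp ((48 + 600 * (L : ℝ) ^ 3) * (60 * (L : ℝ) * (2 * (10 ^ 9 * (L : ℝ) ^ 2)⁻¹ + 2700 * (L : ℝ) * α L))) * (10 ^ 9 * (L : ℝ) ^ 2) * ((L : ℝ) ^ (i.1.2.2 - i.1.2.1))⁻¹ ^ 2 * s * ‖A‖ :=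
        mul_le_mul_of_nonneg_left hA hC0
    _ = ((10 ^ 9 * (L : ℝ) ^ 2) * Real.exp ((48 + 600 * (L : ℝ) ^ 3) * (60 * (L : ℝ) * (2 * (10 ^ 9 * (L : ℝ) ^ 2)⁻¹ + 2700 * (L : ℝ) * α L)))) * ((L : ℝ) ^ (i.1.2.2 - i.1.2.1))⁻¹ ^ 2 * s * ‖A‖ := by ring

/-- `0 ≤ qG L` for the closed constant (the `hqG` side-binder of T1∕O2∕S5x). [folklore] -/
theorem qG_family_closed_nonneg (α : ℕ → ℝ) (L : ℕ) :
    0 ≤ 240 + 6 * ((10 ^ 9 * (L : ℝ) ^ 2) * Real.exp ((48 + 600 * (L : ℝ) ^ 3) * (60 * (L : ℝ) * (2 * (10 ^ 9 * (L : ℝ) ^ 2)⁻¹ + 2700 * (L : ℝ) * α L)))) := by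
  positivity

end Summit.QuantumFields.YangMills.Theorems.Prop7AvgHessGaugeHqGClosed

end
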